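import Mathlib.Data.Real.Basic
import Mathlib.Algebra.BigOperators.Fin
import Mathlib.Algebra.BigOperators.Intervals
import Mathlib.Algebra.Order.BigOperators.Ring.Finset
import Mathlib.Tactic.Linarith
import Mathlib.Tactic.Ring
import Mathlib.Tactic.Positivity
import HarnessLib

/-!
# `NoHeavyLowerTail` (crux stmt-CriticalPhenomena-4575), master-family line P1 (gen 23):
# second-order Harris for sunflowers — the one-variable HUB TRANSFER lemma (pure real algebra, every `k`)

Support file (seat `prim-masterthm-p1`, gen 23; `--supports stmt-CriticalPhenomena-4575`).  Standard axioms, no `sorry`.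
Pure algebra, imported by `…SahiSunflowerOnePayerDichotomy` (dichotomy ⟺ heavier-pays for the typed conjecture
`SahiDeepCore.SunflowerOnePayer k p` of `…SahiSunflowerOnePayer`).

For reals `c_0, c_1, … ≥ 0` put `A_k(t) := Π_{i<k} (t + c_i) − t^k − (Σ_{i<k} c_i)·t^{k−1}`: a polynomial in `t` with
nonnegative coefficients and degree `≤ k − 2` (recursion `auxA_succ`, `auxA_nonneg`), so `A_k(t)/t^{k−2}` is ANTITONE on
`t > 0` — stated cross-multiplied as `auxA_cross`.  Consequence (`prod_add_le_pow_of_prod_add_le_pow`): **for `0 < a ≤ b` and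
`Σ_{i<k} c_i = 1 − a − b`, `Π_{i<k}(a + c_i) ≤ a^{k−1}` implies `Π_{i<k}(b + c_i) ≤ b^{k−1}`** (`k ≥ 2`).  With `a, b` the masses
of the outside and the kernel of a `k`-sunflower and `c_i` the petal masses this says: the branch of the SMALLER hub implies the
branch of the larger hub, i.e. the plain dichotomy "kernel pays or outside pays" already is "the heavier pays".
(Proof of the consequence: `Π(a + c_i) = A(a) + a^{k−1}(a + Σc) = A(a) + a^{k−1}(1 − b)`, so the hypothesis is `A(a) ≤ a^{k−1} b`,
antitonicity gives `A(b) ≤ a b^{k−1}`, and `Π(b + c_i) = A(b) + b^{k−1}(1 − a) ≤ b^{k−1}`.)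
[this work]
-/

noncomputable section

namespace Summit.CriticalPhenomena.PercolationContinuityZ3.Theorems

namespace SahiDeepCore

open Finset

/-! ### 1. One-variable algebra: `A_k(t) = Π_{i<k}(t + c_i) − t^k − (Σ_{i<k} c_i) t^{k−1}` -/

/-- Recursion `A_{k+1}(t) = A_k(t)·(t + c_k) + (Σ_{i<k} c_i)·c_k·t^{k−1}` (`k ≥ 1`). [this work] -/
theorem auxA_succ (c : ℕ → ℝ) (t : ℝ) {k : ℕ} (hk : 1 ≤ k) :
    (∏ i ∈ range (k + 1), (t + c i)) - t ^ (k + 1) - (∑ i ∈ range (k + 1), c i) * t ^ (k + 1 - 1)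
      = ((∏ i ∈ range k, (t + c i)) - t ^ k - (∑ i ∈ range k, c i) * t ^ (k - 1)) * (t + c k)
        + (∑ i ∈ range k, c i) * c k * t ^ (k - 1) := by
  obtain ⟨j, rfl⟩ : ∃ j, k = j + 1 := ⟨k - 1, by omega⟩
  rw [prod_range_succ, sum_range_succ]
  simp only [Nat.add_sub_cancel]
  ring

/-- `A_k(t) ≥ 0` for `t ≥ 0`, `c ≥ 0`, `k ≥ 2` (nonnegative coefficients). [this work] -/
theorem auxA_nonneg (c : ℕ → ℝ) (hc : ∀ i, 0 ≤ c i) {t : ℝ} (ht : 0 ≤ t) {k : ℕ} (hk : 2 ≤ k) :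
    0 ≤ (∏ i ∈ range k, (t + c i)) - t ^ k - (∑ i ∈ range k, c i) * t ^ (k - 1) := by
  induction k, hk using Nat.le_induction with
  | base =>
    have h2 : (∏ i ∈ range 2, (t + c i)) - t ^ 2 - (∑ i ∈ range 2, c i) * t ^ (2 - 1) = c 0 * c 1 := by
      simp only [prod_range_succ, prod_range_zero, sum_range_succ, sum_range_zero]
      norm_num
      ring
    rw [h2]
    exact mul_nonneg (hc 0) (hc 1)
  | succ k hk ih =>
    rw [auxA_succ c t (by omega)]
    have h1 : 0 ≤ t + c k := add_nonneg ht (hc k)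
    have h2 : 0 ≤ ∑ i ∈ range k, c i := sum_nonneg fun i _ => hc i
    have h3 : 0 ≤ t ^ (k - 1) := pow_nonneg ht _
    have h4 := mul_nonneg ih h1
    have h5 := mul_nonneg (mul_nonneg h2 (hc k)) h3
    linarith

/-- ANTITONICITY of `A_k(t)/t^{k−2}` on `t ≥ 0`, cross-multiplied: for `0 ≤ a ≤ b`,
`A_k(b)·a^{k−2} ≤ A_k(a)·b^{k−2}` (`k ≥ 2`). [this work] -/
theorem auxA_cross (c : ℕ → ℝ) (hc : ∀ i, 0 ≤ c i) {a b : ℝ} (ha : 0 ≤ a) (hab : a ≤ b) {k : ℕ} (hk : 2 ≤ k) :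
    ((∏ i ∈ range k, (b + c i)) - b ^ k - (∑ i ∈ range k, c i) * b ^ (k - 1)) * a ^ (k - 2)
      ≤ ((∏ i ∈ range k, (a + c i)) - a ^ k - (∑ i ∈ range k, c i) * a ^ (k - 1)) * b ^ (k - 2) := by
  have hb : 0 ≤ b := le_trans ha hab
  induction k, hk using Nat.le_induction with
  | base =>
    have h2 : ∀ s : ℝ, (∏ i ∈ range 2, (s + c i)) - s ^ 2 - (∑ i ∈ range 2, c i) * s ^ (2 - 1) = c 0 * c 1 := by
      intro s
      simp only [prod_range_succ, prod_range_zero, sum_range_succ, sum_range_zero]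
      norm_num
      ring
    rw [h2 b, h2 a]
    norm_num
  | succ k hk ih =>
    rw [auxA_succ c b (by omega), auxA_succ c a (by omega)]
    set Ab := (∏ i ∈ range k, (b + c i)) - b ^ k - (∑ i ∈ range k, c i) * b ^ (k - 1) with hAb_def
    set Aa := (∏ i ∈ range k, (a + c i)) - a ^ k - (∑ i ∈ range k, c i) * a ^ (k - 1) with hAa_def
    set S := ∑ i ∈ range k, c i with hS_def
    have hAa : 0 ≤ Aa := auxA_nonneg c hc ha hk
    have hS : 0 ≤ S := sum_nonneg fun i _ => hc i
    have hexp : k + 1 - 2 = (k - 2) + 1 := by omega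
    have hexp2 : k - 1 = (k - 2) + 1 := by omega
    simp only [hexp, hexp2, pow_succ]
    have hak : 0 ≤ a ^ (k - 2) := pow_nonneg ha _
    have hbk : 0 ≤ b ^ (k - 2) := pow_nonneg hb _
    have step1 : Ab * a ^ (k - 2) * ((b + c k) * a) ≤ Aa * b ^ (k - 2) * ((b + c k) * a) :=
      mul_le_mul_of_nonneg_right ih (mul_nonneg (add_nonneg hb (hc k)) ha)
    have hcmp : (b + c k) * a ≤ (a + c k) * b := by nlinarith [hc k, hab]
    have step2 : Aa * b ^ (k - 2) * ((b + c k) * a) ≤ Aa * b ^ (k - 2) * ((a + c k) * b) :=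
      mul_le_mul_of_nonneg_left hcmp (mul_nonneg hAa hbk)
    nlinarith [step1, step2, mul_nonneg (mul_nonneg (mul_nonneg hS (hc k)) hak) hbk]

/-- **TRANSFER LEMMA (all `k ≥ 2`).**  For reals `0 < a ≤ b`, `c_i ≥ 0` with `Σ_{i<k} c_i = 1 − a − b`:
`Π_{i<k} (a + c_i) ≤ a^{k−1} ⟹ Π_{i<k} (b + c_i) ≤ b^{k−1}` — the branch of the SMALLER hub implies the branch of the larger.
[this work] -/
theorem prod_add_le_pow_of_prod_add_le_pow (c : ℕ → ℝ) (hc : ∀ i, 0 ≤ c i) {a b : ℝ} (ha : 0 < a) (hab : a ≤ b)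
    {k : ℕ} (hk : 2 ≤ k) (hsum : ∑ i ∈ range k, c i = 1 - a - b)
    (h : ∏ i ∈ range k, (a + c i) ≤ a ^ (k - 1)) : ∏ i ∈ range k, (b + c i) ≤ b ^ (k - 1) := by
  have hcross := auxA_cross c hc ha.le hab hk
  obtain ⟨j, rfl⟩ : ∃ j, k = j + 2 := ⟨k - 2, by omega⟩
  simp only [Nat.add_sub_cancel, show j + 2 - 1 = j + 1 by omega] at hcross h ⊢
  set Ab := (∏ i ∈ range (j + 2), (b + c i)) - b ^ (j + 2) - (∑ i ∈ range (j + 2), c i) * b ^ (j + 1) with hAb_def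
  set Aa := (∏ i ∈ range (j + 2), (a + c i)) - a ^ (j + 2) - (∑ i ∈ range (j + 2), c i) * a ^ (j + 1) with hAa_def
  rw [hsum] at hAb_def hAa_def
  have hb : 0 < b := lt_of_lt_of_le ha hab
  have hpa1 : a ^ (j + 2) = a ^ (j + 1) * a := pow_succ a (j + 1)
  have hpa2 : a ^ (j + 1) = a ^ j * a := pow_succ a j
  have hpb1 : b ^ (j + 2) = b ^ (j + 1) * b := pow_succ b (j + 1)
  have hpb2 : b ^ (j + 1) = b ^ j * b := pow_succ b j
  -- from `h`: `Aa ≤ a^{j+1} b`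
  have hAa_le : Aa ≤ a ^ (j + 1) * b := by
    rw [hAa_def]; nlinarith [h, hpa1]
  -- cross: `Ab a^j ≤ Aa b^j ≤ a^{j+1} b · b^j = (a b^{j+1}) a^j`
  have haj : 0 < a ^ j := pow_pos ha j
  have hbj : 0 ≤ b ^ j := pow_nonneg hb.le j
  have h1 : Ab * a ^ j ≤ (a * b ^ (j + 1)) * a ^ j := by
    calc Ab * a ^ j ≤ Aa * b ^ j := hcross
      _ ≤ (a ^ (j + 1) * b) * b ^ j := mul_le_mul_of_nonneg_right hAa_le hbj
      _ = (a * b ^ (j + 1)) * a ^ j := by rw [hpa2, hpb2]; ring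
  have hAb_le : Ab ≤ a * b ^ (j + 1) := le_of_mul_le_mul_right h1 haj
  rw [hAb_def] at hAb_le
  nlinarith [hAb_le, hpb1]

end SahiDeepCore

end Summit.CriticalPhenomena.PercolationContinuityZ3.Theorems

end
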